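import Summits.AnomalousDissipation.AnomalousDissipation.Theses.ImpulseGrid
import Summits.AnomalousDissipation.AnomalousDissipation.Theorems.BaireTransferDenseLoudDesignerForcesStubGalileanCovariance
import Literature.Analysis.FunctionSpaces.TorusCalculusProofs

/-!
# Stub `stub_galileanDriftTransfer` of the line `Sketch`
# (crux `ImpulseGrid.BoundedEnergyNoLeakGrid`, stmt-AnomalousDissipation-14350)

Sorry-free discharge of the registered stub `stub_galileanDriftTransfer` of the lead's skeleton
(`Cruxes/BoundedEnergyNoLeakGrid`, line `Sketch`): the **Galilean boost of a drift-frame family to the lab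
frame**.  At a fixed grid design `(Φ, G, c)`, put `f := Φ • G` and `V := c e₀`.  If `(w_j, q_j)` are eternal
classical solutions of the Navier–Stokes system on `ℝ × T³` with viscosities `ν_j → 0`, forced by the SWEPT
force `(t, y) ↦ f (y + [tV])` (the force seen in the frame `y = x - [tV]` drifting with the mean momentum),
with momentum-free datum `∫ w_j 0 = 0` and a `j`-uniform forward kinetic-energy cap
`kineticEnergy (w_j t) ≤ E` (`t ≥ 0`), then the boosted family
`u_j t x := V + w_j t (x - [tV])`, `p_j t x := q_j t (x - [tV])` consists of eternal classical solutions
forced by the STEADY force `f`, with drift datum `∫ u_j 0 = V = c e₀` and the forward cap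
`kineticEnergy (u_j t) ≤ ‖V‖² + 2E`:

* classical: the landed Galilean covariance identity
  `DenseLoudDesignerForces.Galilean.Covariance.stub_galileanCovariance`
  (`Theorems/BaireTransferDenseLoudDesignerForcesStubGalileanCovariance.lean`) for the vocabulary
  `sweptForce` / `boost` / `boostScalar` of `Theorems/BaireTransferDenseLoudDesignerForcesLine.lean`, all three
  of which unfold definitionally to the lambdas of the registered signature;
* datum: `[0 • V] = 0`, so `∫ u_j 0 = ∫ (V + w_j 0) = V + ∫ w_j 0 = V` on the probability space `T³`
  (`integral_boost_zero`);
* cap: Haar invariance of the volume of `T³` (`integral_sub_right_eq_self`) and the pointwise bound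
  `‖V + a‖² ≤ 2‖V‖² + 2‖a‖²` give `kineticEnergy (u_j t) ≤ ‖V‖² + 2·kineticEnergy (w_j t)`
  (`kineticEnergy_boost_le`).

The ten design hypotheses on `(Φ, G, c)` and `0 < c` are carried (so that the stub is literally the
skeleton's) but not used.

References: U. Frisch, *Turbulence* (CUP 1995) §5.2 (Galilean invariance of Navier–Stokes);
C. R. Doering, C. Foias, *Energy dissipation in body-forced turbulence*, J. Fluid Mech. 467 (2002) §2.
-/

set_option linter.dupNamespace false

noncomputable section

open MeasureTheory Filter Set
open Literature.Analysis.FunctionSpaces Literature.Analysis.FunctionSpaces.Torus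
open Literature.Analysis.FluidPDE Literature.Analysis.FluidPDE.Torus
open Summit.AnomalousDissipation.AnomalousDissipation.Theorems.DenseLoudDesignerForces.Galilean

namespace Summit.AnomalousDissipation.AnomalousDissipation.Theorems.BoundedEnergyNoLeakGrid

/-- Local notation (verbatim from the lead's skeleton, so that the registered stub signature is matched
character for character): the torus `T³`. -/
local notation "𝕋³" => UnitAddTorus (Fin 3)
/-- Local notation (verbatim from the lead's skeleton): velocity values. -/
local notation "E³" => EuclideanSpace ℝ (Fin 3)

/-! ## Datum and slice energy of a Galilean boost -/

section Boost

/-- **Datum of a boost**: at time `0` the boost is `x ↦ V + w 0 x` (`[0 • V] = 0`), so for a smooth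
momentum-free slice `w 0` its mean over the probability space `T³` is the drift `V`:
`∫ (boost V w) 0 = V + ∫ w 0 = V`. -/
theorem integral_boost_zero {V : E³} {w : ℝ → 𝕋³ → E³} (hw : IsSmooth (w 0))
    (h0 : ∫ y, w 0 y = 0) : ∫ x, boost V w 0 x = V := by
  have h1 : boost V w 0 = fun x => V + w 0 x := by
    funext x
    show V + w 0 (x - Torus.proj ((0 : ℝ) • V)) = V + w 0 x
    rw [zero_smul, Torus.proj_zero, sub_zero]
  rw [h1, integral_add (integrable_const V) hw.integrable, integral_const, probReal_univ, one_smul, h0,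
    add_zero]

/-- **Slice energy of a boost**: for a smooth slice `w t`,
`kineticEnergy (boost V w t) ≤ ‖V‖² + 2·kineticEnergy (w t)` — by Haar invariance of the volume of `T³`,
`∫ ‖V + w t (x - [tV])‖² dx = ∫ ‖V + w t x‖² dx ≤ ∫ (2‖V‖² + 2‖w t x‖²) dx = 2‖V‖² + 2 ∫ ‖w t x‖² dx`
(pointwise `‖V + a‖² ≤ (‖V‖ + ‖a‖)² ≤ 2(‖V‖² + ‖a‖²)`, Mathlib `norm_add_le` and `add_sq_le`). -/
theorem kineticEnergy_boost_le {V : E³} {w : ℝ → 𝕋³ → E³} {t : ℝ} (hw : IsSmooth (w t)) :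
    kineticEnergy (boost V w t) ≤ ‖V‖ ^ 2 + 2 * kineticEnergy (w t) := by
  unfold kineticEnergy
  have hpt : ∀ a : E³, ‖V + a‖ ^ 2 ≤ 2 * ‖V‖ ^ 2 + 2 * ‖a‖ ^ 2 := fun a => by
    have h1 : ‖V + a‖ ^ 2 ≤ (‖V‖ + ‖a‖) ^ 2 := pow_le_pow_left₀ (norm_nonneg _) (norm_add_le V a) 2
    have h2 : (‖V‖ + ‖a‖) ^ 2 ≤ 2 * (‖V‖ ^ 2 + ‖a‖ ^ 2) := add_sq_le
    linarith
  have h1 : ∫ x, ‖boost V w t x‖ ^ 2 = ∫ x, ‖V + w t x‖ ^ 2 :=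
    integral_sub_right_eq_self (μ := (volume : Measure 𝕋³)) (fun y => ‖V + w t y‖ ^ 2)
      (Torus.proj (t • V))
  have hVw : IsSmooth (fun x => V + w t x) := (isSmooth_const V).add hw
  have hiL : Integrable (fun x => ‖V + w t x‖ ^ 2) (volume : Measure 𝕋³) := hVw.norm_sq.integrable
  have hiV : Integrable (fun _ : 𝕋³ => 2 * ‖V‖ ^ 2) (volume : Measure 𝕋³) := integrable_const _
  have hiN : Integrable (fun x => 2 * ‖w t x‖ ^ 2) (volume : Measure 𝕋³) :=
    hw.norm_sq.integrable.const_mul 2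
  have h2 : ∫ x, ‖V + w t x‖ ^ 2 ≤ ∫ x, (2 * ‖V‖ ^ 2 + 2 * ‖w t x‖ ^ 2) :=
    integral_mono hiL (hiV.add hiN) fun x => hpt (w t x)
  have h3 : ∫ x, (2 * ‖V‖ ^ 2 + 2 * ‖w t x‖ ^ 2) = 2 * ‖V‖ ^ 2 + 2 * ∫ x, ‖w t x‖ ^ 2 := by
    rw [integral_add hiV hiN, integral_const, probReal_univ, one_smul, integral_const_mul]
  rw [h1]
  linarith

end Boost

/-! ## The registered stub -/

/-- **stub_galileanDriftTransfer** (registered stub of the line `Sketch`, crux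
`ImpulseGrid.BoundedEnergyNoLeakGrid`).  Galilean boost of a drift-frame family to the lab frame: if
`(w_j, q_j)` are eternal classical solutions forced by the swept force `(t, y) ↦ f (y + [tV])`, `f = Φ • G`,
`V = c e₀`, with `ν_j → 0`, momentum-free datum `∫ w_j 0 = 0` and forward cap `kineticEnergy (w_j t) ≤ E`
(`t ≥ 0`), then `u_j := boost V w_j = (t, x) ↦ V + w_j t (x - [tV])`, `p_j := boostScalar V q_j` are
eternal classical solutions forced by the steady `f` (`Covariance.stub_galileanCovariance`), with drift
datum `∫ u_j 0 = c e₀` (`integral_boost_zero`) and forward cap `kineticEnergy (u_j t) ≤ ‖V‖² + 2E`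
(`kineticEnergy_boost_le`).  The ten design hypotheses and `0 < c` are not used. -/
theorem stub_galileanDriftTransfer :
    ∀ (Φ : 𝕋³ → ℝ) (G : 𝕋³ → E³) (c : ℝ), IsSmooth Φ → IsSmooth G →
    (∀ (s : UnitAddCircle) x, Φ (x + Pi.single (1 : Fin 3) s) = Φ x ∧ Φ (x + Pi.single (2 : Fin 3) s) = Φ x) →
    (∫ x, Φ x = 1) → (∀ (s : UnitAddCircle) x, G (x + Pi.single (0 : Fin 3) s) = G x) → (∀ x, G x 0 = 0) →
    IsSmooth (fun x => Φ x • G x) → IsDivFree (fun x => Φ x • G x) → HasZeroMean (fun x => Φ x • G x) →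
    0 < c →
    (∃ (ν : ℕ → ℝ) (w : ℕ → ℝ → 𝕋³ → E³) (q : ℕ → ℝ → 𝕋³ → ℝ) (E : ℝ),
      (∀ j, 0 < ν j) ∧ Tendsto ν atTop (nhds 0) ∧
      (∀ j, IsClassicalNSSolutionOn Set.univ (ν j)
        (fun t y => Φ (y + Torus.proj (t • (c • EuclideanSpace.single (0 : Fin 3) (1 : ℝ)))) •
          G (y + Torus.proj (t • (c • EuclideanSpace.single (0 : Fin 3) (1 : ℝ))))) (w j) (q j)) ∧
      (∀ j, ∫ y, w j 0 y = 0) ∧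
      (∀ j t, 0 ≤ t → kineticEnergy (w j t) ≤ E)) →
    ∃ (ν : ℕ → ℝ) (u : ℕ → ℝ → 𝕋³ → E³) (p : ℕ → ℝ → 𝕋³ → ℝ) (E : ℝ),
      (∀ j, 0 < ν j) ∧ Tendsto ν atTop (nhds 0) ∧
      (∀ j, IsClassicalNSSolutionOn Set.univ (ν j) (fun _ => fun x => Φ x • G x) (u j) (p j)) ∧
      (∀ j, ∫ x, u j 0 x = c • EuclideanSpace.single (0 : Fin 3) (1 : ℝ)) ∧
      (∀ j t, 0 ≤ t → kineticEnergy (u j t) ≤ E) := by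
  intro Φ G c _ _ _ _ _ _ _ _ _ _ hfam
  obtain ⟨ν, w, q, E, hν, hν0, hcl, hdat, hE⟩ := hfam
  set V : E³ := c • EuclideanSpace.single (0 : Fin 3) (1 : ℝ) with hV
  have hcl' : ∀ j, IsClassicalNSSolutionOn Set.univ (ν j) (sweptForce V fun x => Φ x • G x) (w j) (q j) :=
    hcl
  refine ⟨ν, fun j => boost V (w j), fun j => boostScalar V (q j), ‖V‖ ^ 2 + 2 * E, hν, hν0,
    fun j => Covariance.stub_galileanCovariance (ν j) V (fun x => Φ x • G x) (w j) (q j) (hcl' j),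
    fun j => integral_boost_zero ((hcl j).smooth_velocity.isSmooth_slice (Set.mem_univ 0)) (hdat j),
    fun j t ht => ?_⟩
  have h1 := kineticEnergy_boost_le (V := V) ((hcl j).smooth_velocity.isSmooth_slice (Set.mem_univ t))
  have h2 := hE j t ht
  linarith

end Summit.AnomalousDissipation.AnomalousDissipation.Theorems.BoundedEnergyNoLeakGrid

end
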